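import Summits.ABC.ABC.Theses.CongruentialReceptacle
import HarnessLib

/-!
# Route CongruentialReceptacle — support item `AbelianWeightsVanish` (stmt-ABC-1726)

`AbelianWeightsVanish` says: if integer weights `u q` on primes have logarithmic size
`|u q| ≤ C·log q` and the completely additive function `f n = ∑_{q ∣ n} v_q(n)·u(q)` is
`m`-periodic on the units mod `m`, then for `m ≥ m₀(C)` every prime `p ∤ m` with
`C·log p ≤ m/4` has `u p = 0`.

Proof (the planner's pigeonhole, no literature input). For `C ≤ 0` the size bound already
forces `u p = 0`. For `C > 0` choose `m₀` with `C·log m ≤ m/8` and `2 ≤ m` for all `m ≥ m₀`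
(`log = o(id)`). If `d := |u p| ≠ 0`, put `T := C·log m`, `k := ⌊T/d⌋ + 1` (so
`T < k·d ≤ T + d`) and `b := p^k mod m ∈ [1, m)`, a unit congruent to `p^k`. Periodicity gives
`k·u p = f(p^k) ≡ f(b) (mod m)` with `|f b| ≤ C·log b ≤ T`, hence
`0 < |k·u p − f b| ≤ 2T + d ≤ m/4 + m/4 < m`, contradicting `m ∣ k·u p − f b`.

Closes `--workitem stmt-ABC-1726`; the theorem's type is literally the route decl.
-/

-- `Summit.<Summit>.<Problem>` is the mandated summit-side namespace (CONVENTIONS §2); for the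
-- single-conjunct summit `ABC` the two coincide, so the duplicate `ABC.ABC` is deliberate.
set_option linter.dupNamespace false

namespace Summit.ABC.ABC.Theorems

open Finset

/-- Logarithmic prime weights give a logarithmically bounded completely additive function:
if `|u q| ≤ C·log q` for every prime `q`, then `|∑_{q ∣ n} v_q(n)·u(q)| ≤ C·log n` for every
natural `n` (both sides vanish at `n = 0, 1`), because `log n = ∑_{q ∣ n} v_q(n)·log q`. -/
theorem abs_sum_factorization_mul_weight_le {C : ℝ} {u : ℕ → ℤ}
    (hu : ∀ q : ℕ, q.Prime → |(u q : ℝ)| ≤ C * Real.log q) (n : ℕ) :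
    |((∑ q ∈ n.primeFactors, (n.factorization q : ℤ) * u q : ℤ) : ℝ)| ≤ C * Real.log n := by
  have hlog : Real.log n = ∑ q ∈ n.primeFactors, (n.factorization q : ℝ) * Real.log q := by
    rw [Real.log_nat_eq_sum_factorization, Finsupp.sum, Nat.support_factorization]
  push_cast
  calc |∑ q ∈ n.primeFactors, (n.factorization q : ℝ) * (u q : ℝ)|
      ≤ ∑ q ∈ n.primeFactors, |(n.factorization q : ℝ) * (u q : ℝ)| := abs_sum_le_sum_abs _ _
    _ ≤ ∑ q ∈ n.primeFactors, (n.factorization q : ℝ) * (C * Real.log q) := by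
        refine Finset.sum_le_sum fun q hq => ?_
        rw [abs_mul, Nat.abs_cast]
        exact mul_le_mul_of_nonneg_left (hu q (Nat.prime_of_mem_primeFactors hq)) (Nat.cast_nonneg _)
    _ = C * Real.log n := by
        rw [hlog, Finset.mul_sum]
        exact Finset.sum_congr rfl fun q _ => by ring

/-- On a prime power the completely additive extension is `k·u p`:
`∑_{q ∣ p^k} v_q(p^k)·u(q) = k·u(p)` for `p` prime. -/
theorem sum_factorization_mul_weight_prime_pow (u : ℕ → ℤ) {p : ℕ} (hp : p.Prime) (k : ℕ) :
    (∑ q ∈ (p ^ k).primeFactors, ((p ^ k).factorization q : ℤ) * u q) = (k : ℤ) * u p := by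
  rcases Nat.eq_zero_or_pos k with rfl | hk
  · simp
  · rw [Nat.primeFactors_prime_pow hk.ne' hp, Finset.sum_singleton, hp.factorization_pow,
      Finsupp.single_eq_same]

/-- **`AbelianWeightsVanish` holds** (route `CongruentialReceptacle`, item stmt-ABC-1726):
abelian (mod-`m` periodic on units) prime weights of logarithmic size vanish at every prime
`p ∤ m` with `C·log p ≤ m/4`, once `m ≥ m₀(C)`. Elementary pigeonhole; see the module docstring. -/
theorem abelianWeightsVanish_proof :
    Summit.ABC.ABC.Theses.CongruentialReceptacle.AbelianWeightsVanish := by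
  unfold Summit.ABC.ABC.Theses.CongruentialReceptacle.AbelianWeightsVanish
  intro C
  rcases le_or_gt C 0 with hC | hC
  · -- Degenerate case `C ≤ 0`: the size bound at `p` already gives `|u p| ≤ C·log p ≤ 0`.
    refine ⟨0, fun m _ u hu _ p hp _ _ => ?_⟩
    have hlogp : 0 ≤ Real.log p := Real.log_natCast_nonneg p
    have h : |(u p : ℝ)| ≤ 0 := (hu p hp).trans (mul_nonpos_of_nonpos_of_nonneg hC hlogp)
    exact_mod_cast abs_nonpos_iff.mp h
  · -- Main case `C > 0`.
    -- Step 0: choose `m₀` with `C·log m ≤ m/8` and `2 ≤ m` for all `m ≥ m₀`.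
    have hε : (0 : ℝ) < 1 / (8 * C) := by positivity
    have hev : ∀ᶠ m : ℕ in Filter.atTop, C * Real.log m ≤ (m : ℝ) / 8 ∧ 2 ≤ m := by
      have h1 := (Real.isLittleO_log_id_atTop.bound hε)
      have h2 := tendsto_natCast_atTop_atTop (R := ℝ) |>.eventually h1
      filter_upwards [h2, Filter.eventually_ge_atTop 2] with m hm hm2
      refine ⟨?_, hm2⟩
      have hm0 : (0 : ℝ) ≤ (m : ℝ) := Nat.cast_nonneg m
      rw [id, Real.norm_eq_abs, Real.norm_eq_abs, abs_of_nonneg hm0] at hm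
      calc C * Real.log m ≤ C * |Real.log m| := mul_le_mul_of_nonneg_left (le_abs_self _) hC.le
        _ ≤ C * (1 / (8 * C) * m) := mul_le_mul_of_nonneg_left hm hC.le
        _ = (m : ℝ) / 8 := by field_simp
    obtain ⟨m₀, hm₀⟩ := Filter.eventually_atTop.mp hev
    refine ⟨m₀, fun m hm u hu hper p hp hpm hlogp => ?_⟩
    obtain ⟨hlogm, hm2⟩ := hm₀ m hm
    -- Suppose `u p ≠ 0` and derive a contradiction.
    by_contra hne
    have hmpos : 0 < m := by omega
    have hmR : (0 : ℝ) < (m : ℝ) := by exact_mod_cast hmpos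
    -- `d := |u p| ≥ 1`, and `d ≤ C·log p ≤ m/4`.
    set d : ℤ := |u p| with hd
    have hd1 : (1 : ℤ) ≤ d := Int.one_le_abs hne
    have hdR1 : (1 : ℝ) ≤ (d : ℝ) := by exact_mod_cast hd1
    have hdR0 : (0 : ℝ) < (d : ℝ) := by linarith
    have hdle : (d : ℝ) ≤ (m : ℝ) / 4 := by
      have : ((|u p| : ℤ) : ℝ) = |(u p : ℝ)| := Int.cast_abs
      rw [hd, this]; exact (hu p hp).trans hlogp
    -- `T := C·log m ≥ 0`.
    set T : ℝ := C * Real.log m with hT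
    have hT0 : 0 ≤ T := mul_nonneg hC.le (Real.log_natCast_nonneg m)
    -- `k := ⌊T/d⌋ + 1`, so `T < k·d ≤ T + d`.
    set k : ℕ := ⌊T / d⌋₊ + 1 with hk
    have hk_gt : T < (k : ℝ) * d := by
      have h := Nat.lt_floor_add_one (T / d)
      rw [hk]; push_cast
      calc T = T / d * d := by field_simp
        _ < ((⌊T / (d : ℝ)⌋₊ : ℝ) + 1) * d := mul_lt_mul_of_pos_right h hdR0
    have hk_le : (k : ℝ) * d ≤ T + d := by
      have h := Nat.floor_le (div_nonneg hT0 hdR0.le)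
      rw [hk]; push_cast
      calc ((⌊T / (d : ℝ)⌋₊ : ℝ) + 1) * d ≤ (T / d + 1) * d := by gcongr
        _ = T + d := by field_simp
    -- `b := p^k mod m` is a unit in `[1, m)` congruent to `p^k`.
    set b : ℕ := p ^ k % m with hb
    have hbm : b < m := Nat.mod_lt _ hmpos
    have hpk_cop : (p ^ k).Coprime m := Nat.Coprime.pow_left k hpm
    have hb_cop : b.Coprime m := by
      rw [hb, Nat.Coprime, ← Nat.gcd_rec, Nat.gcd_comm]
      exact hpk_cop
    have hb0 : b ≠ 0 := by
      rintro h0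
      rw [h0, Nat.coprime_zero_left] at hb_cop
      omega
    have hmodEq : p ^ k ≡ b [MOD m] := (Nat.mod_modEq _ _).symm
    -- Periodicity: `k·u p = f(p^k) ≡ f b (mod m)`.
    have hcong := hper (p ^ k) b hpk_cop hb_cop hmodEq
    rw [sum_factorization_mul_weight_prime_pow u hp k] at hcong
    set fb : ℤ := ∑ q ∈ b.primeFactors, (b.factorization q : ℤ) * u q with hfb
    -- `|f b| ≤ C·log b ≤ T`.
    have hfb_le : |(fb : ℝ)| ≤ T := by
      have h1 : |(fb : ℝ)| ≤ C * Real.log b := abs_sum_factorization_mul_weight_le hu b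
      have hb1 : (1 : ℝ) ≤ (b : ℝ) := by exact_mod_cast Nat.one_le_iff_ne_zero.mpr hb0
      have hlogb : Real.log b ≤ Real.log m :=
        Real.log_le_log (by linarith) (by exact_mod_cast hbm.le)
      exact h1.trans (mul_le_mul_of_nonneg_left hlogb hC.le)
    -- The difference `x := k·u p − f b` is a nonzero multiple of `m` of absolute value `< m`.
    have hdvd : (m : ℤ) ∣ (k : ℤ) * u p - fb := (Int.ModEq.dvd hcong.symm)
    have habs_ku : |(((k : ℤ) * u p : ℤ) : ℝ)| = (k : ℝ) * d := by
      push_cast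
      rw [abs_mul, Nat.abs_cast, hd, Int.cast_abs]
    have hx_pos : (0 : ℝ) < |(((k : ℤ) * u p - fb : ℤ) : ℝ)| := by
      have h := abs_sub_abs_le_abs_sub (((k : ℤ) * u p : ℤ) : ℝ) (fb : ℝ)
      push_cast at h habs_ku ⊢
      rw [habs_ku] at h
      linarith
    have hx_lt : |(((k : ℤ) * u p - fb : ℤ) : ℝ)| < (m : ℝ) := by
      have h := abs_sub (((k : ℤ) * u p : ℤ) : ℝ) (fb : ℝ)
      push_cast at h habs_ku ⊢
      rw [habs_ku] at h
      have h8 : T ≤ (m : ℝ) / 8 := hlogm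
      linarith
    have hx0 : (k : ℤ) * u p - fb = 0 := by
      refine Int.eq_zero_of_abs_lt_dvd hdvd ?_
      have : ((|(k : ℤ) * u p - fb| : ℤ) : ℝ) < ((m : ℤ) : ℝ) := by
        rw [Int.cast_abs]; exact_mod_cast hx_lt
      exact_mod_cast this
    have : |(((k : ℤ) * u p - fb : ℤ) : ℝ)| = 0 := by rw [hx0]; simp
    linarith

end Summit.ABC.ABC.Theorems
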